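import Summits.CriticalPhenomena.PercolationContinuityZ3.Theorems.PercNearOneGluingNoHeavyQuantGluedWindowTwoRowShare
import HarnessLib

/-!
# QUANT lane R8, T-DEC: LEMMA W's pair condition — the FAR-TOP cell of the two-row regime (h a mid, `h` and `h+r` UNREACHABLE for both low copies of `l`:
# `l + h + 2r ≤ T`, the top copy `A = l+r+k` reachable: `T < 2l+r+k`) PROVED WITHOUT THE CONJECTURE by hand — the first cell of the heavy-bottom family
# (arm-1 gen 61, architect)

builds on p205010 (kernel theorem, internal audit signed; external expert review pending)

Support file (`--supports stmt-CriticalPhenomena-4575`), QUANT lane seat prim-quant-arm-1 (gen 61, architect); memo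
`run/shared/lean/prim/quant/prim-quant-arm-1-g61/ARCH-G61.md` §4.  Theorems only; standard axioms, no sorries, no definitions.

THE CELL.  Band frame and price system of `gluedPullback_windowPair_of_lemmaW`; light window pair `(l, h)` (at `T₀`) below a cheap atom `c ≥ h`; two-row regime
with `h` a mid; `l + h + 2r ≤ T` (so NEITHER low copy of `l` can use `h` or `h+r`: the only absorbers are the top copy `A` — capacity `(1−γ)t₂`, exact heavy power
`ϖ_A = (2l+r+k−T)/(T−2l)` for row `l`, exact heavy `ϖ_B = (2l+2r+k−T)/(T−2l−2r)` or exact light `(1−G_B)/G_B` for row `l+r` — and the giants at the plain rate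
`u = y/(1−y)`, power `(1−y)/y`).  In box coordinates (`ν = N/d ≥ 1+2ε`, `κ = (r+k)/d > ν`, `ε = r/d`) this is a 2 × 2 transport problem with EQUAL pool rates, so
"row `l+r` into `A` first" is exact, and both resulting inequalities are three-line consequences of `α = A/d ≤ t₁ε + t₂κ`, `ρ₀ = ν − α`, `(y − ρ₀)² ≥ 0`:
(i) `t₁ ≤ t₂ϖ_B` (always in the light status): `(1−γ)(t₀ − (1−θ)t₂ϖ_A) ≤ γt₂(1−y)/y`, `θ = t₁/(t₂ϖ_B)`, via `ν·ϖ_A ≤ (ν−ε)·ϖ_B` (`farTop_ratio_heavy/_light`: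
for the light power this is `(κ−ν)² ≥ 0`) ⟹ `Y·ν ≤ ν − t₂κ − t₁ε ≤ ρ₀` and `farTop_core`: `(1−γ)ρ₀ ≤ γt₂(1−y)/y`; (ii) `t₂ϖ_B < t₁` (heavy status):
`(1−γ)(t₀ + t₁ − t₂ϖ_B) ≤ γt₂(1−y)/y` via `1 + ϖ_B = (κ−ε)/(ν−2ε)`.  **`gluedPullback_windowPair_twoRow_farTop`** — patterns `H--u ∣ l--u`, `H--u ∣ H--u` of the
census (≈ 13 % of the heavy-bottom family, memo §4); no light-at-T hypothesis, no branch hypothesis.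

HONEST STATUS.  `GluedLemmaW` (flow form), `GluedDominatedMass`, the band, `SiblingStep`, `FarTreeRow` OPEN; RATE class (log\*) / honest sentence of
`run/shared/lean/prim/quant/README.md` unchanged.  [this work].  Nothing here is cited as a published result.  The gluing rows served
[cite: KozmaNitzan2024, Conjecture 3 (p. 15)]; product measure [cite: Grimmett1999, §1.3 p. 10].
-/

set_option maxHeartbeats 4000000

noncomputable section

namespace Summit.CriticalPhenomena.PercolationContinuityZ3.Theorems
namespace Quant
namespace LawDec

/-- **core**: `0 < y ≤ t₂`, `y < 1`, `γ = y² + (1−y)ρ₀` ⟹ `(1−γ)ρ₀ ≤ γt₂(1−y)/y` (it is `(1+y−ρ₀)ρ₀ ≤ γ`, i.e. `(y−ρ₀)² ≥ 0`, and `t₂ ≥ y`). [this work] -/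
theorem farTop_core (y t2 ρ₀ : ℝ) (hy0 : 0 < y) (hy1 : y < 1) (hyt2 : y ≤ t2) (hρ0 : 0 ≤ ρ₀) :
    (1 - (y ^ 2 + (1 - y) * ρ₀)) * ρ₀ ≤ (y ^ 2 + (1 - y) * ρ₀) * t2 * ((1 - y) / y) := by
  rw [show (y ^ 2 + (1 - y) * ρ₀) * t2 * ((1 - y) / y) = ((y ^ 2 + (1 - y) * ρ₀) * t2 * (1 - y)) / y by ring, le_div_iff₀ hy0]
  have h1y : 0 < 1 - y := by linarith
  have hG0 : 0 ≤ y ^ 2 + (1 - y) * ρ₀ := by positivity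
  -- (1−γ)ρ₀ y ≤ γ y (1−y) ≤ γ t2 (1−y)
  have step : (1 - (y ^ 2 + (1 - y) * ρ₀)) * ρ₀ * y ≤ (y ^ 2 + (1 - y) * ρ₀) * y * (1 - y) := by
    have e : (y ^ 2 + (1 - y) * ρ₀) * y * (1 - y) - (1 - (y ^ 2 + (1 - y) * ρ₀)) * ρ₀ * y = y * (1 - y) * (y - ρ₀) ^ 2 := by ring
    nlinarith [mul_nonneg (mul_nonneg hy0.le h1y.le) (sq_nonneg (y - ρ₀))]
  nlinarith [mul_le_mul_of_nonneg_left hyt2 (mul_nonneg hG0 h1y.le)]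

/-- ratio bound, HEAVY middle copy: `ν·(κ−ν)/ν ≤ (ν−ε)·(κ+ε−ν)/(ν−2ε)` for `0 ≤ 2ε < ν ≤ κ`. [this work] -/
theorem farTop_ratio_heavy (nu e k : ℝ) (he0 : 0 ≤ e) (hn2 : 2 * e < nu) (hkn : nu ≤ k) :
    nu * ((k - nu) / nu) ≤ (nu - e) * ((k + e - nu) / (nu - 2 * e)) := by
  have hn0 : 0 < nu := by linarith
  have hm0 : 0 < nu - 2 * e := by linarith
  rw [mul_div_cancel₀ _ hn0.ne', ← mul_div_assoc, le_div_iff₀ hm0]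
  nlinarith [mul_nonneg he0 (show (0:ℝ) ≤ k - nu by linarith), mul_nonneg he0 he0]

/-- ratio bound, LIGHT middle copy: with `G = y² + (1−y)(ν−2ε)/(κ−ε)`, `yκ ≤ ν < κ`, `0 ≤ 2ε < ν`, `ν − 2ε ≤ y(κ−ε)`, `0 < y < 1`:
`ν·(κ−ν)/ν ≤ (ν−ε)·(1−G)/G` — i.e. `G ≤ (ν−ε)/(κ−ε)`, which is `(κ−ν)² ≥ 0`. [this work] -/
theorem farTop_ratio_light (y nu e k : ℝ) (hy0 : 0 < y) (hy1 : y < 1) (he0 : 0 ≤ e) (hn2 : 2 * e < nu) (hkn : nu < k) (hky : y * k ≤ nu)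
    (hlight : nu - 2 * e ≤ y * (k - e)) :
    nu * ((k - nu) / nu) ≤ (nu - e) * ((1 - (y ^ 2 + (1 - y) * ((nu - 2 * e) / (k - e)))) / (y ^ 2 + (1 - y) * ((nu - 2 * e) / (k - e)))) := by
  have hn0 : 0 < nu := by linarith
  have hke : 0 < k - e := by linarith
  have h1y : 0 < 1 - y := by linarith
  obtain ⟨ρ, hρ⟩ : ∃ ρ : ℝ, ρ = (nu - 2 * e) / (k - e) := ⟨_, rfl⟩
  have hρ0 : 0 ≤ ρ := by rw [hρ]; exact div_nonneg (by linarith) hke.le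
  have hρy : ρ ≤ y := by rw [hρ, div_le_iff₀ hke]; linarith
  have hG0 : 0 < y ^ 2 + (1 - y) * ρ := by positivity
  rw [← hρ, mul_div_cancel₀ _ hn0.ne', ← mul_div_assoc, le_div_iff₀ hG0]
  -- goal: (k − ν)·G ≤ (ν − ε)(1 − G);  i.e. G (k − ε) ≤ ν − ε
  have hyk : y ≤ nu / k := by rw [le_div_iff₀ (by linarith)]; linarith
  -- G ≤ (ν/k)² + (1 − ν/k)ρ  (G increasing in y on [ρ/2, 1], and y ≤ ν/k ≤ 1)
  have hsk1 : nu / k ≤ 1 := by rw [div_le_one (by linarith)]; linarith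
  have hGmono : y ^ 2 + (1 - y) * ρ ≤ (nu / k) ^ 2 + (1 - nu / k) * ρ := by
    have e1 : (nu / k) ^ 2 + (1 - nu / k) * ρ - (y ^ 2 + (1 - y) * ρ) = (nu / k - y) * (nu / k + y - ρ) := by ring
    nlinarith [mul_nonneg (sub_nonneg.2 hyk) (show (0:ℝ) ≤ nu / k + y - ρ by linarith)]
  -- ((ν/k)² + (1−ν/k)ρ)(k−ε) ≤ ν − ε  ⟺  (k−ν)² ≥ 0 (after clearing k²(k−e))
  have hk0 : 0 < k := by linarith
  have key : ((nu / k) ^ 2 + (1 - nu / k) * ρ) * (k - e) ≤ nu - e := by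
    rw [hρ]
    have e2 : ((nu / k) ^ 2 + (1 - nu / k) * ((nu - 2 * e) / (k - e))) * (k - e)
        = (nu ^ 2 * (k - e) + k * (k - nu) * (nu - 2 * e)) / k ^ 2 := by
      field_simp
      try ring
    rw [e2, div_le_iff₀ (pow_pos hk0 2)]
    nlinarith [mul_nonneg he0 (sq_nonneg (k - nu))]
  have := mul_le_mul_of_nonneg_right hGmono hke.le
  nlinarith [this, key, hG0]

/-- **THE FAR-TOP CELL OF THE TWO-ROW REGIME (h a mid)**: `l + h + 2r ≤ T` (neither low copy of `l` can use `h` or `h + r`) and `T < 2l + r + k` (the bottom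
copy can use the top copy) ⟹ `(1−γ)Ψ(l) + γΨ(h) ≤ 0` for every price system and every cheap `c ≥ h` — no `GluedLemmaW`, no status or branch hypothesis.
[this work] -/
theorem gluedPullback_windowPair_twoRow_farTop (x a q g S : ℝ) (B r k j l h c ls : ℕ) (α p : ℕ → ℝ)
    (hx0 : 0 < x) (hx1 : x < 1) (ha0 : 0 < a) (ha1 : a ≤ 1) (hq0 : 0 < q) (hq1 : q < 1) (hg0 : 0 ≤ g) (hg1 : g ≤ 1) (hr : 1 ≤ r) (hk : 1 ≤ k)
    (hxqg : x ≤ q * g)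
    (hlh : l < h) (hhB : h ≤ B) (hwin : j < h + r + k) (hlow : 2 * (l : ℝ) < a * S) (hcomp : a * S < (l : ℝ) + h)
    (hlight : pairGate (a * x) (a * S) l h < a * x)
    (hL2j : l + r + k ≤ j) (hL2mid : a * (S + q * ((r : ℝ) + k * g)) ≤ 2 * ((l : ℝ) + r + k))
    (hL1low : 2 * ((l : ℝ) + r) < a * (S + q * ((r : ℝ) + k * g))) (hhmid : a * (S + q * ((r : ℝ) + k * g)) ≤ 2 * (h : ℝ))
    (hAcomp : a * (S + q * ((r : ℝ) + k * g)) < 2 * (l : ℝ) + r + k)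
    (hfar : (l : ℝ) + h + 2 * r ≤ a * (S + q * ((r : ℝ) + k * g)))
    (hhc : h ≤ c) (hcB : c ≤ B) (hcj : c ≤ j)
    (hp : ∀ h, 0 ≤ p h)
    (hαp : ∀ l' h', l' ≤ j → 2 * (l' : ℝ) < a * (S + q * ((r : ℝ) + k * g)) → h' ≤ B + (r + k) →
      (j + 1 ≤ h' ∨ a * (S + q * ((r : ℝ) + k * g)) < (l' : ℝ) + h') →
      α l' ≤ usage (a * x) (a * (S + q * ((r : ℝ) + k * g))) j l' h' * p h')
    (hcheap : -(gluedPullback (a * (S + q * ((r : ℝ) + k * g))) q g j r k α p c) * (a * x)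
      < (1 - a * x) * gluedPullback (a * (S + q * ((r : ℝ) + k * g))) q g j r k α p ls) :
    (1 - pairGate (a * x) (a * S) l h) * gluedPullback (a * (S + q * ((r : ℝ) + k * g))) q g j r k α p l
      + pairGate (a * x) (a * S) l h * gluedPullback (a * (S + q * ((r : ℝ) + k * g))) q g j r k α p h ≤ 0 := by
  -- names (no `set`: the reduction theorem is applied to the original expressions at the end)
  obtain ⟨y, hy⟩ : ∃ y : ℝ, y = a * x := ⟨_, rfl⟩
  obtain ⟨T, hT⟩ : ∃ T : ℝ, T = a * (S + q * ((r : ℝ) + k * g)) := ⟨_, rfl⟩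
  obtain ⟨T₀, hT₀⟩ : ∃ T₀ : ℝ, T₀ = a * S := ⟨_, rfl⟩
  have hy0 : 0 < y := by rw [hy]; exact mul_pos ha0 hx0
  have hyx : y ≤ x := by rw [hy]; nlinarith
  have hy1 : y < 1 := by linarith
  have h1y : 0 < 1 - y := by linarith
  obtain ⟨t1, ht1⟩ : ∃ t1 : ℝ, t1 = q * (1 - g) := ⟨_, rfl⟩
  obtain ⟨t2, ht2⟩ : ∃ t2 : ℝ, t2 = q * g := ⟨_, rfl⟩
  have ht1p : 0 ≤ t1 := by rw [ht1]; exact mul_nonneg hq0.le (by linarith)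
  have ht2p : 0 ≤ t2 := by rw [ht2]; exact mul_nonneg hq0.le hg0
  have ht0p : 0 ≤ 1 - t1 - t2 := by
    rw [ht1, ht2, show 1 - q * (1 - g) - q * g = 1 - q by ring]; linarith
  have hyt2 : y ≤ t2 := by rw [ht2]; linarith
  have hr1 : (1:ℝ) ≤ r := by exact_mod_cast hr
  have hk0 : (0:ℝ) ≤ k := Nat.cast_nonneg k
  have hr0 : (0:ℝ) ≤ r := by linarith
  have hlh' : (l : ℝ) < h := by exact_mod_cast hlh
  -- geometry: d = h − l, N = T − 2l, A = T − T₀ ≤ m = t1 r + t2 (r+k)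
  obtain ⟨d, hd⟩ : ∃ d : ℝ, d = (h : ℝ) - l := ⟨_, rfl⟩
  have hd0 : 0 < d := by rw [hd]; linarith
  obtain ⟨N, hN⟩ : ∃ N : ℝ, N = T - 2 * (l : ℝ) := ⟨_, rfl⟩
  have hA : T - T₀ = a * (q * ((r : ℝ) + k * g)) := by rw [hT, hT₀]; ring
  have em : q * (1 - g) * (r : ℝ) + q * g * ((r : ℝ) + k) = q * ((r : ℝ) + k * g) := by ring
  have hAm : T - T₀ ≤ t1 * r + t2 * ((r : ℝ) + k) := by
    rw [hA, ht1, ht2]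
    have h1 : a * (q * ((r : ℝ) + k * g)) ≤ 1 * (q * ((r : ℝ) + k * g)) :=
      mul_le_mul_of_nonneg_right ha1 (by positivity)
    linarith [h1, em]
  have hA0 : 0 ≤ T - T₀ := by rw [hA]; positivity
  have hN0 : 0 < N := by rw [hN, hT]; linarith
  have hNK : N < (r : ℝ) + k := by rw [hN, hT]; linarith              -- row l compatible with A
  have hNfar : d + 2 * (r : ℝ) ≤ N := by rw [hN, hd, hT]; linarith      -- h and h + r unreachable for both rows
  have h2rN : 2 * (r : ℝ) < N := by rw [hN, hT]; linarith
  -- y (r+k) ≤ a m ≤ N: the bottom copy is HEAVY for the top copy (automatic in the band)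
  have hxq : x ≤ q := le_trans hxqg (by nlinarith)
  have hxK : x * ((r : ℝ) + k) ≤ q * ((r : ℝ) + k * g) := by
    have e1 : x * (r : ℝ) ≤ q * r := mul_le_mul_of_nonneg_right hxq hr0
    have e2 : x * (k : ℝ) ≤ q * g * k := mul_le_mul_of_nonneg_right hxqg hk0
    linarith [e1, e2]
  have hyK : y * ((r : ℝ) + k) ≤ N := by
    have e1 : y * ((r : ℝ) + k) ≤ T - T₀ := by
      rw [hy, hA, mul_assoc]; exact mul_le_mul_of_nonneg_left hxK ha0.le
    rw [hN]; rw [hT₀] at e1; linarith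
  -- the light gate of the first factor
  obtain ⟨ρ₀, hρ₀⟩ : ∃ ρ₀ : ℝ, ρ₀ = (T₀ - 2 * (l : ℝ)) / ((h : ℝ) - l) := ⟨_, rfl⟩
  have hρ₀y : ρ₀ < y := by
    have : (T₀ - 2 * (l : ℝ)) / ((h : ℝ) - l) ≤ pairGate y T₀ l h := le_max_left _ _
    rw [hρ₀]; rw [hy, hT₀] at this ⊢; linarith
  obtain ⟨γ, hγ⟩ : ∃ γ : ℝ, γ = y ^ 2 + (1 - y) * ρ₀ := ⟨_, rfl⟩
  have hγ' : pairGate (a * x) (a * S) l h = γ := by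
    rw [hγ, hρ₀, hT₀, hy]; exact pairGate_eq_light (a * x) (a * S) l h (mul_pos ha0 hx0).le (by rw [← hy, ← hT₀, ← hρ₀]; exact hρ₀y.le)
  have eρ₀ : ρ₀ = (N - (T - T₀)) / d := by rw [hρ₀, hN, hd]; congr 1; ring
  have hρ₀0 : 0 < ρ₀ := by rw [hρ₀]; exact div_pos (by rw [hT₀]; linarith) (by linarith)
  have hγ0 : 0 < γ := by rw [hγ]; exact add_pos_of_pos_of_nonneg (pow_pos hy0 2) (mul_pos h1y hρ₀0).le
  have h1γ : 0 < 1 - γ := by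
    rw [hγ, show 1 - (y ^ 2 + (1 - y) * ρ₀) = (1 - y) * (1 + y - ρ₀) by ring]; exact mul_pos h1y (by linarith)
  have hlowl : 2 * (l : ℝ) < T := by linarith
  have eLr : ((l + r : ℕ) : ℝ) = (l : ℝ) + r := by push_cast; ring
  have eL2 : ((l + r + k : ℕ) : ℝ) = (l : ℝ) + r + k := by push_cast; ring
  have hlowlr : 2 * ((l + r : ℕ) : ℝ) < T := by rw [eLr]; linarith
  -- the top copy A = l + r + k: exact heavy power for row l
  obtain ⟨ϖA, hϖA⟩ : ∃ ϖA : ℝ, ϖA = ((l : ℝ) + ((l + r + k : ℕ) : ℝ) - T) / (T - 2 * (l : ℝ)) := ⟨_, rfl⟩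
  have hAcomp' : T < (l : ℝ) + ((l + r + k : ℕ) : ℝ) := by rw [eL2]; rw [hN] at hNK; linarith
  have hAheavy : y * ((((l + r + k : ℕ) : ℝ)) - l) ≤ T - 2 * (l : ℝ) := by rw [eL2, ← hN]; linarith [hyK]
  have vA : ϖA * usage y T j l (l + r + k) ≤ 1 := by
    have e := GluedWindow.apow_heavy_valid y T 1 j l (l + r + k) hy0 hy1 hL2j hlowl hAcomp' hAheavy
    rw [← hϖA, one_mul] at e
    exact e.le
  have eϖA : ϖA = ((r : ℝ) + k - N) / N := by rw [hϖA, eL2, hN]; congr 1; ring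
  have hϖA0 : 0 ≤ ϖA := by rw [eϖA]; exact div_nonneg (by linarith) hN0.le
  -- box coordinates
  obtain ⟨nu, hnu⟩ : ∃ nu : ℝ, nu = N / d := ⟨_, rfl⟩
  obtain ⟨ee, hee⟩ : ∃ ee : ℝ, ee = (r : ℝ) / d := ⟨_, rfl⟩
  obtain ⟨kk, hkk⟩ : ∃ kk : ℝ, kk = ((r : ℝ) + k) / d := ⟨_, rfl⟩
  obtain ⟨aa, haa⟩ : ∃ aa : ℝ, aa = (T - T₀) / d := ⟨_, rfl⟩
  have hnu1 : 1 + 2 * ee ≤ nu := by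
    rw [hnu, hee, show 1 + 2 * ((r : ℝ) / d) = (d + 2 * r) / d by field_simp, div_le_div_iff₀ hd0 hd0]
    exact mul_le_mul_of_nonneg_right hNfar hd0.le
  have hee0 : 0 ≤ ee := by rw [hee]; positivity
  have hn0 : 0 < nu := by linarith
  have hn2 : 2 * ee < nu := by linarith
  have hkkn : nu < kk := by rw [hkk, hnu]; exact div_lt_div_of_pos_right hNK hd0
  have hkky : y * kk ≤ nu := by rw [hkk, hnu, ← mul_div_assoc]; exact div_le_div_of_nonneg_right hyK hd0.le
  have eϖA' : ϖA = (kk - nu) / nu := by rw [eϖA, hnu, hkk, ← sub_div, div_div_div_cancel_right₀ hd0.ne']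
  have eρ₀' : ρ₀ = nu - aa := by rw [eρ₀, hnu, haa, sub_div]
  have haamax : aa ≤ t1 * ee + t2 * kk := by
    rw [haa, hee, hkk, show t1 * ((r : ℝ) / d) + t2 * (((r : ℝ) + k) / d) = (t1 * r + t2 * ((r : ℝ) + k)) / d by ring]
    exact div_le_div_of_nonneg_right hAm hd0.le
  -- the pool power (plain giant rate) and the core inequality
  obtain ⟨pu, hpu⟩ : ∃ pu : ℝ, pu = (1 - y) / y := ⟨_, rfl⟩
  have hpu0 : 0 ≤ pu := by rw [hpu]; exact div_nonneg h1y.le hy0.le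
  have vP : pu * (y / (1 - y)) ≤ 1 := by rw [hpu, div_mul_div_comm, mul_comm (1 - y) y, div_self (mul_ne_zero hy0.ne' h1y.ne')]
  have core : (1 - γ) * ρ₀ ≤ γ * t2 * pu := by rw [hγ, hpu]; exact farTop_core y t2 ρ₀ hy0 hy1 hyt2 hρ₀0.le
  have et0 : 1 - t1 - t2 = 1 - q := by rw [ht1, ht2]; ring
  have hι01 : ∀ ι : ℝ, ((h + r ≤ j ∧ ι = 0) ∨ (j < h + r ∧ ι = 1)) → 0 ≤ ι := by
    rintro ι (⟨_, e⟩ | ⟨_, e⟩) <;> norm_num [e]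
  -- the middle copy into A, by status, and the certificate
  obtain ⟨ι, hι⟩ : ∃ ι : ℝ, (h + r ≤ j ∧ ι = 0) ∨ (j < h + r ∧ ι = 1) := by
    by_cases hjr : h + r ≤ j
    · exact ⟨0, Or.inl ⟨hjr, rfl⟩⟩
    · exact ⟨1, Or.inr ⟨by omega, rfl⟩⟩
  have hι0 := hι01 ι hι
  have hpool_extra : 0 ≤ γ * (ι * t1) * pu := mul_nonneg (mul_nonneg hγ0.le (mul_nonneg hι0 ht1p)) hpu0
  -- generic final step: given a valid power ϖB ≥ 0 for (l+r, A) with ν ϖA ≤ (ν − ee) ϖB, and either t1 ≤ t2 ϖB, or the bound 1 + ϖB ≥ (kk−ee)/(nu−2ee)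
  have finish : ∀ ϖB : ℝ, 0 ≤ ϖB → ϖB * usage y T j (l + r) (l + r + k) ≤ 1 → nu * ϖA ≤ (nu - ee) * ϖB →
      (t1 ≤ t2 * ϖB ∨ (kk - ee) / (nu - 2 * ee) ≤ 1 + ϖB) →
      (1 - pairGate (a * x) (a * S) l h) * gluedPullback (a * (S + q * ((r : ℝ) + k * g))) q g j r k α p l
        + pairGate (a * x) (a * S) l h * gluedPullback (a * (S + q * ((r : ℝ) + k * g))) q g j r k α p h ≤ 0 := by
    intro ϖB hϖB0 vB hratio hcase
    have hBcomp' : T < ((l + r : ℕ) : ℝ) + ((l + r + k : ℕ) : ℝ) := by rw [eLr, eL2]; rw [hN] at hNK; linarith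
    by_cases hfit : t1 ≤ t2 * ϖB
    · -- case (i): row l+r ↦ θ of A; row l ↦ 1−θ of A and the whole pool
      have ht2pos : 0 < t2 := lt_of_lt_of_le hy0 hyt2
      obtain ⟨θ, hθ0, hθ1, hθc⟩ : ∃ θ : ℝ, 0 ≤ θ ∧ θ ≤ 1 ∧ θ * (t2 * ϖB) = t1 := by
        by_cases hB0 : t2 * ϖB = 0
        · refine ⟨0, le_rfl, zero_le_one, ?_⟩
          rw [hB0] at hfit; rw [zero_mul]; linarith
        · have hBpos : 0 < t2 * ϖB := lt_of_le_of_ne (mul_nonneg ht2p hϖB0) (Ne.symm hB0)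
          exact ⟨t1 / (t2 * ϖB), div_nonneg ht1p hBpos.le, (div_le_one hBpos).mpr hfit, div_mul_cancel₀ _ hBpos.ne'⟩
      -- main (i): (1−γ)(t0 − (1−θ) t2 ϖA) ≤ γ t2 pu
      have hYν : ((1 - t1 - t2) - (1 - θ) * t2 * ϖA) * nu ≤ ρ₀ := by
        have e1 : ((1 - t1 - t2) - (1 - θ) * t2 * ϖA) * nu = nu - t1 * nu - t2 * (nu + nu * ϖA) + θ * t2 * (nu * ϖA) := by ring
        have e2 : nu + nu * ϖA = kk := by rw [eϖA', mul_div_cancel₀ _ hn0.ne']; ring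
        have h3 : θ * t2 * (nu * ϖA) ≤ θ * t2 * ((nu - ee) * ϖB) := mul_le_mul_of_nonneg_left hratio (mul_nonneg hθ0 ht2p)
        have e4 : θ * t2 * ((nu - ee) * ϖB) = θ * (t2 * ϖB) * (nu - ee) := by ring
        rw [e4, hθc] at h3
        rw [e1, e2]
        linarith [h3, haamax, eρ₀']
      have main : (1 - γ) * ((1 - t1 - t2) - (1 - θ) * t2 * ϖA) ≤ γ * t2 * pu := by
        by_cases hYs : (1 - t1 - t2) - (1 - θ) * t2 * ϖA ≤ 0
        · exact le_trans (mul_nonpos_of_nonneg_of_nonpos h1γ.le hYs) (mul_nonneg (mul_nonneg hγ0.le ht2p) hpu0)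
        · have hYpos : 0 < (1 - t1 - t2) - (1 - θ) * t2 * ϖA := lt_of_not_ge hYs
          have hYle : (1 - t1 - t2) - (1 - θ) * t2 * ϖA ≤ ρ₀ := by
            have hp := mul_nonneg hYpos.le (show (0:ℝ) ≤ nu - 1 by linarith)
            linarith [hYν, hp]
          exact le_trans (mul_le_mul_of_nonneg_left hYle h1γ.le) core
      have h1θ : 0 ≤ 1 - θ := by linarith
      refine gluedPullback_windowPair_twoRow_mid_of_assign x a q g S B r k j l h c ls α p ι ϖA 0 0 pu ϖB 0 0 pu
        (1 - θ) 0 0 1 θ 0 0 0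
        hx0 hx1 ha0 ha1 hq0 hq1 hg0 hg1 hr hlh hhB hwin hlow hcomp hL2j hL2mid hL1low hhmid hι hhc hcB hcj hp hαp hcheap
        hϖA0 le_rfl le_rfl hpu0 hϖB0 le_rfl le_rfl hpu0 h1θ le_rfl le_rfl zero_le_one hθ0 le_rfl le_rfl le_rfl
        (by linarith) (by linarith) (by linarith) (by linarith)
        ?_ (Or.inr ?_) ?_ (Or.inl rfl) ?_ (Or.inl rfl) (Or.inl ?_) ?_ (Or.inr ?_) ?_ (Or.inl rfl) ?_ (Or.inl rfl) (Or.inl ?_) ?_ ?_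
      · rw [← hy, ← hT]; exact vA
      · rw [← hT, ← eL2]; exact hAcomp'
      · rw [zero_mul]; exact zero_le_one
      · rw [zero_mul]; exact zero_le_one
      · rw [← hy]; exact vP
      · rw [← hy, ← hT]; exact vB
      · rw [← hT, ← eL2, ← eLr]; exact hBcomp'
      · rw [zero_mul]; exact zero_le_one
      · rw [zero_mul]; exact zero_le_one
      · rw [← hy]; exact vP
      · rw [hγ', ← ht1, ← ht2, ← et0]
        have e : (1 - θ) * ((1 - γ) * t2 * ϖA) + 0 * (γ * (1 - t1 - t2) * 0) + 0 * (γ * t1 * (1 - ι) * 0) + 1 * (γ * (t2 + ι * t1) * pu)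
            = (1 - γ) * ((1 - θ) * t2 * ϖA) + γ * t2 * pu + γ * (ι * t1) * pu := by ring
        rw [e]; linarith [main, hpool_extra]
      · rw [hγ', ← ht1, ← ht2]
        have e : θ * ((1 - γ) * t2 * ϖB) + 0 * (γ * (1 - q) * 0) + 0 * (γ * t1 * (1 - ι) * 0) + 0 * (γ * (t2 + ι * t1) * pu)
            = θ * (t2 * ϖB) * (1 - γ) := by ring
        rw [e, hθc, mul_comm]
    · -- case (ii): row l+r ↦ all of A and the share φ of the pool; row l ↦ the rest of the pool
      have hfit' : t2 * ϖB < t1 := lt_of_not_ge hfit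
      have hcase' : (kk - ee) / (nu - 2 * ee) ≤ 1 + ϖB := by
        rcases hcase with h1 | h1
        · exact absurd h1 hfit
        · exact h1
      -- main (ii): (1−γ)(t0 + t1 − t2 ϖB) ≤ γ t2 pu
      have hW : (1 - t1 - t2) + t1 - t2 * ϖB ≤ ρ₀ := by
        have hm0 : 0 < nu - 2 * ee := by linarith
        have h2 : t2 * (kk - ee) ≤ t2 * ((nu - 2 * ee) * (1 + ϖB)) := by
          refine mul_le_mul_of_nonneg_left ?_ ht2p
          have := mul_le_mul_of_nonneg_left hcase' hm0.le
          rwa [mul_div_cancel₀ _ hm0.ne'] at this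
        -- (t0 + t1 − t2 ϖB)(ν − 2ee) ≤ ν − 2ee − t2(kk − ee) ≤ ρ₀, and ν − 2ee ≥ 1
        have h3 : ((1 - t1 - t2) + t1 - t2 * ϖB) * (nu - 2 * ee) ≤ nu - 2 * ee - t2 * kk + t2 * ee := by linarith [h2]
        have h4 : nu - 2 * ee - t2 * kk + t2 * ee ≤ ρ₀ := by
          linarith [haamax, eρ₀', mul_nonneg hee0 ht0p, hee0]
        by_cases hs : (1 - t1 - t2) + t1 - t2 * ϖB ≤ 0
        · linarith [hρ₀0]
        · have hpos : 0 < (1 - t1 - t2) + t1 - t2 * ϖB := lt_of_not_ge hs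
          have hp := mul_nonneg hpos.le (show (0:ℝ) ≤ nu - 2 * ee - 1 by linarith)
          linarith [h3, h4, hp]
      have main : (1 - γ) * ((1 - t1 - t2) + t1 - t2 * ϖB) ≤ γ * t2 * pu := le_trans (mul_le_mul_of_nonneg_left hW h1γ.le) core
      have hpool0 : 0 < γ * t2 * pu := by
        have ht2pos : 0 < t2 := lt_of_lt_of_le hy0 hyt2
        have hpupos : 0 < pu := by rw [hpu]; exact div_pos h1y hy0
        positivity
      obtain ⟨φ, hφ⟩ : ∃ φ : ℝ, φ = (1 - γ) * (t1 - t2 * ϖB) / (γ * t2 * pu) := ⟨_, rfl⟩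
      have hφ0 : 0 ≤ φ := by rw [hφ]; exact div_nonneg (mul_nonneg h1γ.le (by linarith)) hpool0.le
      have hφc : φ * (γ * t2 * pu) = (1 - γ) * (t1 - t2 * ϖB) := by rw [hφ]; exact div_mul_cancel₀ _ hpool0.ne'
      have hφ1 : φ ≤ 1 := by
        rw [hφ, div_le_one hpool0]; linarith [main, mul_nonneg h1γ.le ht0p]
      have h1φ : 0 ≤ 1 - φ := by linarith
      refine gluedPullback_windowPair_twoRow_mid_of_assign x a q g S B r k j l h c ls α p ι ϖA 0 0 pu ϖB 0 0 pu
        0 0 0 (1 - φ) 1 0 0 φ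
        hx0 hx1 ha0 ha1 hq0 hq1 hg0 hg1 hr hlh hhB hwin hlow hcomp hL2j hL2mid hL1low hhmid hι hhc hcB hcj hp hαp hcheap
        hϖA0 le_rfl le_rfl hpu0 hϖB0 le_rfl le_rfl hpu0 le_rfl le_rfl le_rfl h1φ zero_le_one le_rfl le_rfl hφ0
        (by linarith) (by linarith) (by linarith) (by linarith)
        ?_ (Or.inr ?_) ?_ (Or.inl rfl) ?_ (Or.inl rfl) (Or.inl ?_) ?_ (Or.inr ?_) ?_ (Or.inl rfl) ?_ (Or.inl rfl) (Or.inl ?_) ?_ ?_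
      · rw [← hy, ← hT]; exact vA
      · rw [← hT, ← eL2]; exact hAcomp'
      · rw [zero_mul]; exact zero_le_one
      · rw [zero_mul]; exact zero_le_one
      · rw [← hy]; exact vP
      · rw [← hy, ← hT]; exact vB
      · rw [← hT, ← eL2, ← eLr]; exact hBcomp'
      · rw [zero_mul]; exact zero_le_one
      · rw [zero_mul]; exact zero_le_one
      · rw [← hy]; exact vP
      · rw [hγ', ← ht1, ← ht2, ← et0]
        have e : 0 * ((1 - γ) * t2 * ϖA) + 0 * (γ * (1 - t1 - t2) * 0) + 0 * (γ * t1 * (1 - ι) * 0) + (1 - φ) * (γ * (t2 + ι * t1) * pu)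
            = γ * t2 * pu - φ * (γ * t2 * pu) + (1 - φ) * (γ * (ι * t1) * pu) := by ring
        rw [e, hφc]
        linarith [main, mul_nonneg h1φ hpool_extra]
      · rw [hγ', ← ht1, ← ht2]
        have e : 1 * ((1 - γ) * t2 * ϖB) + 0 * (γ * (1 - q) * 0) + 0 * (γ * t1 * (1 - ι) * 0) + φ * (γ * (t2 + ι * t1) * pu)
            = (1 - γ) * t2 * ϖB + φ * (γ * t2 * pu) + φ * (γ * (ι * t1) * pu) := by ring
        rw [e, hφc]; linarith [mul_nonneg hφ0 hpool_extra]
  -- instantiate by the status of the middle copy w.r.t. A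
  by_cases hBst : y * (k : ℝ) ≤ N - 2 * (r : ℝ)
  · -- heavy: exact heavy power
    obtain ⟨ϖB, hϖB⟩ : ∃ ϖB : ℝ, ϖB = (((l + r : ℕ) : ℝ) + ((l + r + k : ℕ) : ℝ) - T) / (T - 2 * ((l + r : ℕ) : ℝ)) := ⟨_, rfl⟩
    have hBcomp' : T < ((l + r : ℕ) : ℝ) + ((l + r + k : ℕ) : ℝ) := by rw [eLr, eL2]; rw [hN] at hNK; linarith
    have hBheavy' : y * ((((l + r + k : ℕ) : ℝ)) - ((l + r : ℕ) : ℝ)) ≤ T - 2 * ((l + r : ℕ) : ℝ) := by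
      rw [eL2, eLr, show (l : ℝ) + r + k - ((l : ℝ) + r) = k by ring]; rw [hN] at hBst; linarith
    have vB : ϖB * usage y T j (l + r) (l + r + k) ≤ 1 := by
      have e := GluedWindow.apow_heavy_valid y T 1 j (l + r) (l + r + k) hy0 hy1 hL2j hlowlr hBcomp' hBheavy'
      rw [← hϖB, one_mul] at e
      exact e.le
    have eϖB1 : ϖB = ((r : ℝ) + k + r - N) / (N - 2 * (r : ℝ)) := by rw [hϖB, eL2, eLr, hN]; congr 1 <;> ring
    have eϖB : ϖB = (kk + ee - nu) / (nu - 2 * ee) := by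
      rw [eϖB1, hkk, hee, hnu, ← add_div, ← sub_div, show N / d - 2 * ((r : ℝ) / d) = (N - 2 * r) / d by ring,
        div_div_div_cancel_right₀ hd0.ne']
    have hϖB0 : 0 ≤ ϖB := by rw [eϖB]; exact div_nonneg (by linarith) (by linarith)
    refine finish ϖB hϖB0 vB ?_ (Or.inr ?_)
    · rw [eϖA', eϖB]; exact farTop_ratio_heavy nu ee kk hee0 hn2 hkkn.le
    · rw [eϖB, show 1 + (kk + ee - nu) / (nu - 2 * ee) = (kk - ee) / (nu - 2 * ee) by
        rw [eq_div_iff (show nu - 2 * ee ≠ 0 by linarith), add_mul, div_mul_cancel₀ _ (show nu - 2 * ee ≠ 0 by linarith)]; ring]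
  · -- light: exact light power
    have hBlight : N - 2 * (r : ℝ) ≤ y * (k : ℝ) := (lt_of_not_ge hBst).le
    obtain ⟨ρB, hρB⟩ : ∃ ρB : ℝ, ρB = (T - 2 * ((l + r : ℕ) : ℝ)) / ((((l + r + k : ℕ) : ℝ)) - ((l + r : ℕ) : ℝ)) := ⟨_, rfl⟩
    have hk0' : (0:ℝ) < k := by linarith
    have eρB : ρB = (N - 2 * (r : ℝ)) / k := by rw [hρB, eL2, eLr, hN]; congr 1 <;> ring
    have hρBy : ρB ≤ y := by rw [eρB, div_le_iff₀ hk0']; linarith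
    have hρB0 : 0 ≤ ρB := by rw [eρB]; exact div_nonneg (by linarith) hk0'.le
    obtain ⟨GB, hGB⟩ : ∃ GB : ℝ, GB = y ^ 2 + (1 - y) * ρB := ⟨_, rfl⟩
    have hGBy : GB ≤ y := by rw [hGB]; nlinarith [mul_le_mul_of_nonneg_left hρBy h1y.le]
    have hGB0 : 0 < GB := by rw [hGB]; exact add_pos_of_pos_of_nonneg (pow_pos hy0 2) (mul_nonneg h1y.le hρB0)
    have hGB1 : 0 < 1 - GB := by linarith
    obtain ⟨ϖB, hϖB⟩ : ∃ ϖB : ℝ, ϖB = (1 - GB) / GB := ⟨_, rfl⟩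
    have hϖB0 : 0 ≤ ϖB := by rw [hϖB]; exact div_nonneg hGB1.le hGB0.le
    have vB : ϖB * usage y T j (l + r) (l + r + k) ≤ 1 := by
      rw [usage_light_eq y T j (l + r) (l + r + k) hy0.le hL2j (by rw [← hρB]; exact hρBy), ← hρB, ← hGB, hϖB, div_mul_div_comm,
        mul_comm (1 - GB) GB, div_self (mul_ne_zero hGB0.ne' hGB1.ne')]
    have eρB' : ρB = (nu - 2 * ee) / (kk - ee) := by
      rw [eρB, hnu, hee, hkk, ← sub_div, show N / d - 2 * ((r : ℝ) / d) = (N - 2 * r) / d by ring, show (r : ℝ) + k - r = k by ring,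
        div_div_div_cancel_right₀ hd0.ne']
    have hBl : nu - 2 * ee ≤ y * (kk - ee) := by
      rw [hnu, hee, hkk, show N / d - 2 * ((r : ℝ) / d) = (N - 2 * r) / d by ring, show y * (((r : ℝ) + k) / d - (r : ℝ) / d) = (y * k) / d by ring]
      exact div_le_div_of_nonneg_right hBlight hd0.le
    -- row l+r always fits: t1 ≤ 1 − y ≤ t2 ϖB
    have hfit : t1 ≤ t2 * ϖB := by
      have hϖBge : (1 - y) / y ≤ ϖB := by rw [hϖB, div_le_div_iff₀ hy0 hGB0]; nlinarith [hGBy]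
      have h1 : 1 - y ≤ t2 * ϖB := by
        calc 1 - y = y * ((1 - y) / y) := by field_simp
          _ ≤ t2 * ϖB := mul_le_mul hyt2 hϖBge (div_nonneg h1y.le hy0.le) ht2p
      linarith
    refine finish ϖB hϖB0 vB ?_ (Or.inl hfit)
    rw [eϖA', hϖB, hGB, eρB']; exact farTop_ratio_light y nu ee kk hy0 hy1 hee0 hn2 hkkn hkky hBl

end LawDec
end Quant
end Summit.CriticalPhenomena.PercolationContinuityZ3.Theorems
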